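import Summits.Ventures.PercRepro.Night2NearFatFair

/-!
# night-2: THE NON-SUSPECT FAMILY WITH THE PER-FACE HITTING COUNT (gen 40)

The Bonferroni count of Night2HitCap charges every active face `5 · C(N − 2, i)`; the face at a basis point `a` of a basis
line `cl {a, b}` meets that line only in `b` (`rk (cl (Q.erase a) ∩ cl {a, b}) ≤ 5 + 2 − 6 = 1`), so it holds at most
`N − d` points of `W` when the line carries `d` (Night2NearFatNineLine's `inter_face_inter_line_eq_empty`) —
**`card_filter_forall_not_subset_ge'`**, **`card_filter_good_ge'`** (the per-face count).  `ntpIncomeB N s d₁ d₂ e₁ e₂ f` charges `3 C(N−2, i) + 2 C(f, i)` at the non-top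
levels; **`basis_pair_fair_of_ntpB`** is the fair-share theorem for a basis pair whose faces at `a, b` hold `≤ f` points of `W`.
Paper: proofs/NIGHT-2-g40.md §10.
-/

namespace PercRepro.Shadow

open PercRepro.ThmH PercRepro.PerFlat

variable {α : Type*} [DecidableEq α] {M : Matroid α} [M.Finite] {G : Finset α}

/-- The income from the start level `s` with the per-face hitting count: three faces of `≤ N − 2` points and two of `≤ f`. -/
noncomputable def ntpIncomeB (N s d₁ d₂ e₁ e₂ f : ℕ) : ℚ :=
  ∑ i ∈ Finset.range (N + 1), if s ≤ i then
    (if N ≤ i + 3 then (1 : ℚ) else 11 / 18) *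
      max 0 (((N.choose i : ℕ) : ℚ) -
        (if N ≤ i + 3 then (0 : ℚ) else 3 * (((N - 2).choose i : ℕ) : ℚ) + 2 * ((f.choose i : ℕ) : ℚ)) -
        ((suspBound N i d₁ d₂ e₁ e₂ : ℕ) : ℚ)) * 3 / (((i + 5).choose 4 : ℕ) : ℚ)
  else 0

omit [DecidableEq α] in
/-- **The per-face abstract count**: the `i`-subsets of `O` contained in none of the `C w` number at least
`C(|O|, i) − Σ_{w ∈ A} C(|C w ∩ O|, i)`. -/
theorem card_filter_forall_not_subset_ge' [DecidableEq α] {β : Type*} [DecidableEq β] (O : Finset α) (A : Finset β)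
    (C : β → Finset α) (i : ℕ) :
    ((O.card.choose i : ℕ) : ℚ) - ∑ w ∈ A, (((C w ∩ O).card.choose i : ℕ) : ℚ) ≤
      (((O.powersetCard i).filter (fun Y => ∀ w ∈ A, ¬ Y ⊆ C w)).card : ℚ) := by
  have hsplit := Finset.card_filter_add_card_filter_not (s := O.powersetCard i)
    (fun Y => ∀ w ∈ A, ¬ Y ⊆ C w)
  rw [Finset.card_powersetCard] at hsplit
  have hbad : ((O.powersetCard i).filter (fun Y => ¬ ∀ w ∈ A, ¬ Y ⊆ C w)).card ≤
      ∑ w ∈ A, (C w ∩ O).card.choose i := by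
    have hsub : (O.powersetCard i).filter (fun Y => ¬ ∀ w ∈ A, ¬ Y ⊆ C w) ⊆
        A.biUnion (fun w => (C w ∩ O).powersetCard i) := by
      intro Y hY
      rw [Finset.mem_filter, Finset.mem_powersetCard] at hY
      obtain ⟨⟨hYO, hYi⟩, hbad⟩ := hY
      obtain ⟨w, hw, hYC⟩ : ∃ w ∈ A, Y ⊆ C w := by
        by_contra h
        exact hbad (fun w hw hYC => h ⟨w, hw, hYC⟩)
      rw [Finset.mem_biUnion]
      exact ⟨w, hw, Finset.mem_powersetCard.2 ⟨Finset.subset_inter hYC hYO, hYi⟩⟩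
    refine le_trans (Finset.card_le_card hsub) ?_
    refine le_trans Finset.card_biUnion_le ?_
    apply le_of_eq
    apply Finset.sum_congr rfl
    intro w _
    rw [Finset.card_powersetCard]
  have h1 : ((((O.powersetCard i).filter (fun Y => ∀ w ∈ A, ¬ Y ⊆ C w)).card : ℕ) : ℚ) +
      ((((O.powersetCard i).filter (fun Y => ¬ ∀ w ∈ A, ¬ Y ⊆ C w)).card : ℕ) : ℚ) =
      ((O.card.choose i : ℕ) : ℚ) := by exact_mod_cast hsplit
  have h2 : ((((O.powersetCard i).filter (fun Y => ¬ ∀ w ∈ A, ¬ Y ⊆ C w)).card : ℕ) : ℚ) ≤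
      ∑ w ∈ A, (((C w ∩ O).card.choose i : ℕ) : ℚ) := by exact_mod_cast hbad
  linarith

omit [DecidableEq α] in
/-- **The good `i`-subsets with the per-face count.** -/
theorem card_filter_good_ge' [DecidableEq α] {β : Type*} [DecidableEq β] (W : Finset α) (A : Finset β) (D : β → Finset α)
    (S : Finset α → Prop) [DecidablePred S] (i : ℕ) :
    ((W.card.choose i : ℕ) : ℚ) - ∑ w ∈ A, (((D w ∩ W).card.choose i : ℕ) : ℚ) -
        (((W.powersetCard i).filter S).card : ℚ) ≤
      (((W.powersetCard i).filter (fun Y => ¬ S Y ∧ ∀ w ∈ A, ¬ Y ⊆ D w)).card : ℚ) := by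
  have h1 := card_filter_forall_not_subset_ge' W A D i
  have hsplit := Finset.card_filter_add_card_filter_not (s := (W.powersetCard i).filter (fun Y => ∀ w ∈ A, ¬ Y ⊆ D w))
    (fun Y => S Y)
  rw [Finset.filter_filter, Finset.filter_filter] at hsplit
  have hle : ((W.powersetCard i).filter (fun Y => (∀ w ∈ A, ¬ Y ⊆ D w) ∧ S Y)).card ≤
      ((W.powersetCard i).filter S).card := by
    apply Finset.card_le_card
    intro Y hY
    rw [Finset.mem_filter] at hY ⊢
    exact ⟨hY.1, hY.2.2⟩
  have heq : (W.powersetCard i).filter (fun Y => (∀ w ∈ A, ¬ Y ⊆ D w) ∧ ¬ S Y) =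
      (W.powersetCard i).filter (fun Y => ¬ S Y ∧ ∀ w ∈ A, ¬ Y ⊆ D w) := by
    apply Finset.filter_congr
    intro Y _
    tauto
  rw [heq] at hsplit
  have h2 : ((((W.powersetCard i).filter (fun Y => (∀ w ∈ A, ¬ Y ⊆ D w) ∧ S Y)).card : ℕ) : ℚ) +
      ((((W.powersetCard i).filter (fun Y => ¬ S Y ∧ ∀ w ∈ A, ¬ Y ⊆ D w)).card : ℕ) : ℚ) =
      ((((W.powersetCard i).filter (fun Y => ∀ w ∈ A, ¬ Y ⊆ D w)).card : ℕ) : ℚ) := by exact_mod_cast hsplit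
  have h3 : ((((W.powersetCard i).filter (fun Y => (∀ w ∈ A, ¬ Y ⊆ D w) ∧ S Y)).card : ℕ) : ℚ) ≤
      ((((W.powersetCard i).filter S).card : ℕ) : ℚ) := by exact_mod_cast hle
  linarith

omit [DecidableEq α] in
/-- **The abstract regrouping from the start level `s`.** -/
theorem ntpIncomeB_le_sum_filter (W : Finset α) (P : Finset α → Prop) [DecidablePred P] (s d₁ d₂ e₁ e₂ f : ℕ)
    (hcount : ∀ i, s ≤ i →
      ((W.card.choose i : ℕ) : ℚ) -
        (if W.card ≤ i + 3 then (0 : ℚ) else 3 * (((W.card - 2).choose i : ℕ) : ℚ) + 2 * ((f.choose i : ℕ) : ℚ)) -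
        ((suspBound W.card i d₁ d₂ e₁ e₂ : ℕ) : ℚ) ≤ (((W.powersetCard i).filter P).card : ℚ)) :
    ntpIncomeB W.card s d₁ d₂ e₁ e₂ f ≤
      ∑ Y ∈ W.powerset.filter (fun Y => s ≤ Y.card ∧ P Y),
        (if W.card ≤ Y.card + 3 then (1 : ℚ) else 11 / 18) * 3 / (((Y.card + 5).choose 4 : ℕ) : ℚ) := by
  set fam : Finset (Finset α) := W.powerset.filter (fun Y => s ≤ Y.card ∧ P Y) with hfam
  have hmaps : ∀ Y ∈ fam, Y.card ∈ Finset.range (W.card + 1) := fun Y hY =>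
    Finset.mem_range.2 (Nat.lt_succ_of_le (Finset.card_le_card
      (Finset.mem_powerset.1 (Finset.mem_filter.1 hY).1)))
  have hfiber := Finset.sum_fiberwise_of_maps_to hmaps
    (fun Y => (if W.card ≤ Y.card + 3 then (1 : ℚ) else 11 / 18) * 3 / (((Y.card + 5).choose 4 : ℕ) : ℚ))
  rw [← hfiber]
  unfold ntpIncomeB
  apply Finset.sum_le_sum
  intro i _
  have hfib : ∑ Y ∈ fam.filter (fun Y => Y.card = i),
      (if W.card ≤ Y.card + 3 then (1 : ℚ) else 11 / 18) * 3 / (((Y.card + 5).choose 4 : ℕ) : ℚ) =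
      ((fam.filter (fun Y => Y.card = i)).card : ℚ) *
        ((if W.card ≤ i + 3 then (1 : ℚ) else 11 / 18) * 3 / (((i + 5).choose 4 : ℕ) : ℚ)) := by
    rw [Finset.sum_congr rfl (fun Y hY => by rw [(Finset.mem_filter.1 hY).2])]
    rw [Finset.sum_const, nsmul_eq_mul]
  rw [hfib]
  by_cases hsi : s ≤ i
  · rw [if_pos hsi]
    have hsub : (W.powersetCard i).filter P ⊆ fam.filter (fun Y => Y.card = i) := by
      intro Y hY
      rw [Finset.mem_filter, Finset.mem_powersetCard] at hY
      obtain ⟨⟨hYW, hYi⟩, hP⟩ := hY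
      rw [Finset.mem_filter, hfam, Finset.mem_filter, Finset.mem_powerset]
      exact ⟨⟨hYW, by omega, hP⟩, hYi⟩
    have hcard : (((W.powersetCard i).filter P).card : ℚ) ≤ ((fam.filter (fun Y => Y.card = i)).card : ℚ) := by
      exact_mod_cast Finset.card_le_card hsub
    set w : ℚ := (if W.card ≤ i + 3 then (1 : ℚ) else 11 / 18) with hw
    set c : ℚ := (if W.card ≤ i + 3 then (0 : ℚ) else 3 * (((W.card - 2).choose i : ℕ) : ℚ) + 2 * ((f.choose i : ℕ) : ℚ)) with hc
    have hw0 : 0 ≤ w := by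
      rw [hw]
      split_ifs <;> norm_num
    have hC : (0 : ℚ) ≤ w * 3 / (((i + 5).choose 4 : ℕ) : ℚ) := by positivity
    have hmax : max 0 (((W.card.choose i : ℕ) : ℚ) - c - ((suspBound W.card i d₁ d₂ e₁ e₂ : ℕ) : ℚ)) ≤
        ((fam.filter (fun Y => Y.card = i)).card : ℚ) :=
      max_le (by positivity) (le_trans (hcount i hsi) hcard)
    calc w * max 0 (((W.card.choose i : ℕ) : ℚ) - c - ((suspBound W.card i d₁ d₂ e₁ e₂ : ℕ) : ℚ)) * 3 /
          (((i + 5).choose 4 : ℕ) : ℚ)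
        = max 0 (((W.card.choose i : ℕ) : ℚ) - c - ((suspBound W.card i d₁ d₂ e₁ e₂ : ℕ) : ℚ)) *
            (w * 3 / (((i + 5).choose 4 : ℕ) : ℚ)) := by ring
      _ ≤ ((fam.filter (fun Y => Y.card = i)).card : ℚ) * (w * 3 / (((i + 5).choose 4 : ℕ) : ℚ)) :=
          mul_le_mul_of_nonneg_right hmax hC
  · rw [if_neg hsi]
    have hw0 : (0 : ℚ) ≤ (if W.card ≤ i + 3 then (1 : ℚ) else 11 / 18) := by
      split_ifs <;> norm_num
    positivity


/-- **The non-suspect top-or-hitting targets from the start level `s` with the per-face hitting count** are targets of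
income at least `ntpIncomeB N s |ℓ₁| |ℓ₂| |C₁| |C₂| f` when the faces at `a, b` hold `≤ f` points of `W`. -/
theorem ntpB_targets_subset_and_income (hG : G ∈ flatsQ M (5 + 1)) (hd : (gr M \ G).card = 2)
    (hk : kColoops M G = 1) (hnf : fatClosures M 5 G 2 = ∅)
    {B : Finset α} (hB : B ∈ thinMembers M 5 G) (hnP : ¬ bigP M G B) {z : α} (hz : z ∈ G \ clF M B)
    (hl0 : loss M 5 G B z ≠ 0) {ℓ₁ ℓ₂ C₁ C₂ : Finset α} {s f : ℕ} (hs1 : 1 ≤ s) {a b : α}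
    (ha : a ∈ insert z B \ coloops M G) (hb : b ∈ insert z B \ coloops M G) (hab : a ≠ b)
    (hfa : ((G \ insert z B) ∩ clF M ((insert z B).erase a)).card ≤ f)
    (hfb : ((G \ insert z B) ∩ clF M ((insert z B).erase b)).card ≤ f)
    (hdl : ∀ Y ⊆ G \ insert z B, s ≤ Y.card →
      ¬ ((∃ a ∈ insert z B \ coloops M G, ∃ b ∈ insert z B \ coloops M G, a ≠ b ∧
          Y.card ≤ (Y ∩ clF M {a, b}).card + 1) ∨
        ∃ a ∈ insert z B \ coloops M G, ∃ y ∈ Y, Y ⊆ clF M {a, y}) →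
      dload M 5 G (bigP M G) (dshGT2 M 5 G) (insert z B ∪ Y) = 0)
    (hℓ₁ : ℓ₁ ⊆ G \ insert z B) (hℓ₂ : ℓ₂ ⊆ G \ insert z B)
    (hB2 : ∀ a ∈ insert z B \ coloops M G, ∀ b ∈ insert z B \ coloops M G, a ≠ b →
      (G \ insert z B) ∩ clF M {a, b} ⊆ ℓ₁ ∨ (G \ insert z B) ∩ clF M {a, b} ⊆ ℓ₂ ∨
        ((G \ insert z B) ∩ clF M {a, b}).card + 2 ≤ s)
    (hB1 : ∀ a ∈ insert z B \ coloops M G, ∀ y ∈ G \ insert z B,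
      (G \ insert z B) ∩ clF M {a, y} ⊆ C₁ ∨ (G \ insert z B) ∩ clF M {a, y} ⊆ C₂ ∨
        ((G \ insert z B) ∩ clF M {a, y}).card + 1 ≤ s) :
    (((G \ insert z B).powerset.filter (fun Y => s ≤ Y.card ∧
        (¬ ((∃ a ∈ insert z B \ coloops M G, ∃ b ∈ insert z B \ coloops M G, a ≠ b ∧
            Y.card ≤ (Y ∩ clF M {a, b}).card + 1) ∨
          ∃ a ∈ insert z B \ coloops M G, ∃ y ∈ Y, Y ⊆ clF M {a, y}) ∧
        ((G \ insert z B).card ≤ Y.card + 3 ∨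
          ∀ w ∈ (insert z B \ coloops M G).filter (fun w => faceOk M G (insert z B) w),
            ¬ Y ⊆ clF M ((insert z B).erase w))))).image (fun Y => insert z B ∪ Y)) ⊆ tgtSets M 5 G B z ∧
      ntpIncomeB (G \ insert z B).card s ℓ₁.card ℓ₂.card C₁.card C₂.card f ≤
        ∑ T ∈ ((G \ insert z B).powerset.filter (fun Y => s ≤ Y.card ∧
          (¬ ((∃ a ∈ insert z B \ coloops M G, ∃ b ∈ insert z B \ coloops M G, a ≠ b ∧
              Y.card ≤ (Y ∩ clF M {a, b}).card + 1) ∨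
            ∃ a ∈ insert z B \ coloops M G, ∃ y ∈ Y, Y ⊆ clF M {a, y}) ∧
            ((G \ insert z B).card ≤ Y.card + 3 ∨
            ∀ w ∈ (insert z B \ coloops M G).filter (fun w => faceOk M G (insert z B) w),
              ¬ Y ⊆ clF M ((insert z B).erase w))))).image (fun Y => insert z B ∪ Y),
          vCap M G T / faceSum M G T := by
  set W := G \ insert z B with hW
  set Susp : Finset α → Prop := fun Y =>
    (∃ a ∈ insert z B \ coloops M G, ∃ b ∈ insert z B \ coloops M G, a ≠ b ∧
      Y.card ≤ (Y ∩ clF M {a, b}).card + 1) ∨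
    ∃ a ∈ insert z B \ coloops M G, ∃ y ∈ Y, Y ⊆ clF M {a, y} with hSusp
  set Hit : Finset α → Prop := fun Y =>
    ∀ w ∈ (insert z B \ coloops M G).filter (fun w => faceOk M G (insert z B) w),
      ¬ Y ⊆ clF M ((insert z B).erase w) with hHit
  set P : Finset α → Prop := fun Y => ¬ Susp Y ∧ (W.card ≤ Y.card + 3 ∨ Hit Y) with hP
  set fam : Finset (Finset α) := W.powerset.filter (fun Y => s ≤ Y.card ∧ P Y) with hfam
  set 𝒯 : Finset (Finset α) := fam.image (fun Y => insert z B ∪ Y) with h𝒯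
  have hmem : ∀ Y ∈ fam, Y ⊆ W ∧ s ≤ Y.card ∧ P Y := by
    intro Y hY
    rw [hfam, Finset.mem_filter, Finset.mem_powerset] at hY
    exact ⟨hY.1, hY.2.1, hY.2.2⟩
  have h𝒯sub : 𝒯 ⊆ tgtSets M 5 G B z := by
    intro T hT
    rw [h𝒯, Finset.mem_image] at hT
    obtain ⟨Y, hY, rfl⟩ := hT
    obtain ⟨hYW, hYc, -⟩ := hmem Y hY
    rw [tgtSets_eq_image hG (mem_thinMembers.1 hB).1 hz, Finset.mem_image]
    refine ⟨Y, Finset.mem_filter.2 ⟨Finset.mem_powerset.2 hYW, ?_⟩, rfl⟩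
    rw [← Finset.card_pos]
    omega
  have hinj : Set.InjOn (fun Y => insert z B ∪ Y) (fam : Set (Finset α)) := by
    intro Y₁ hY₁ Y₂ hY₂ heq
    rw [Finset.mem_coe] at hY₁ hY₂
    have key : ∀ Y ∈ fam, (insert z B ∪ Y) ∩ W = Y := by
      intro Y hY
      ext x
      rw [Finset.mem_inter, Finset.mem_union]
      constructor
      · rintro ⟨hx | hx, hxW⟩
        · exact absurd hx (Finset.mem_sdiff.1 hxW).2
        · exact hx
      · intro hx
        exact ⟨Or.inr hx, (hmem Y hY).1 hx⟩
    have h1 := key Y₁ hY₁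
    have h2 := key Y₂ hY₂
    simp only at heq
    rw [← h1, ← h2, heq]
  have hterm : ∀ Y ∈ fam, (if W.card ≤ Y.card + 3 then (1 : ℚ) else 11 / 18) * 3 /
      (((Y.card + 5).choose 4 : ℕ) : ℚ) ≤ vCap M G (insert z B ∪ Y) / faceSum M G (insert z B ∪ Y) := by
    intro Y hY
    obtain ⟨hYW, hYc, hnS, hYtop⟩ := hmem Y hY
    have hne : Y.Nonempty := by
      rw [← Finset.card_pos]
      omega
    exact free_term hG hd hk hnf hB hnP hz hl0 hYW hne (hdl Y hYW hYc hnS) hYtop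
  have hsum𝒯 : ∑ Y ∈ fam, (if W.card ≤ Y.card + 3 then (1 : ℚ) else 11 / 18) * 3 /
      (((Y.card + 5).choose 4 : ℕ) : ℚ) ≤ ∑ T ∈ 𝒯, vCap M G T / faceSum M G T := by
    rw [h𝒯, Finset.sum_image hinj]
    exact Finset.sum_le_sum hterm
  refine ⟨h𝒯sub, le_trans ?_ hsum𝒯⟩
  apply ntpIncomeB_le_sum_filter W P s
  intro i hsi
  have hSusp := card_filter_suspect_basis_le hs1 hℓ₁ hℓ₂ hB2 hB1 hsi
  have hSusp' : (((W.powersetCard i).filter Susp).card : ℚ) ≤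
      ((suspBound W.card i ℓ₁.card ℓ₂.card C₁.card C₂.card : ℕ) : ℚ) := by exact_mod_cast hSusp
  by_cases htop : W.card ≤ i + 3
  · rw [if_pos htop]
    have hsplit := Finset.card_filter_add_card_filter_not (s := W.powersetCard i) Susp
    rw [Finset.card_powersetCard] at hsplit
    have hsub : (W.powersetCard i).filter (fun Y => ¬ Susp Y) ⊆ (W.powersetCard i).filter P := by
      intro Y hY
      rw [Finset.mem_filter] at hY ⊢
      have hYi : Y.card = i := (Finset.mem_powersetCard.1 hY.1).2
      exact ⟨hY.1, hY.2, Or.inl (by omega)⟩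
    have h1 : (((W.powersetCard i).filter (fun Y => ¬ Susp Y)).card : ℚ) ≤
        (((W.powersetCard i).filter P).card : ℚ) := by exact_mod_cast Finset.card_le_card hsub
    have h2 : (((W.powersetCard i).filter Susp).card : ℚ) +
        (((W.powersetCard i).filter (fun Y => ¬ Susp Y)).card : ℚ) = ((W.card.choose i : ℕ) : ℚ) := by
      exact_mod_cast hsplit
    linarith
  · rw [if_neg htop]
    have hQG : insert z B ⊆ G :=
      Finset.insert_subset (Finset.mem_sdiff.1 hz).1 (subset_G_of_mem_thinMembers hB)
    set A := (insert z B \ coloops M G).filter (fun w => faceOk M G (insert z B) w) with hA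
    -- the per-face sum: three faces of `≤ N − 2` points, the faces at `a, b` of `≤ f`
    have hface : ∀ w ∈ A, w ≠ a → w ≠ b → (clF M ((insert z B).erase w) ∩ W).card + 2 ≤ W.card := by
      intro w hw _ _
      have hok := (Finset.mem_filter.1 hw).2
      have h2 : 2 ≤ (W \ clF M ((insert z B).erase w)).card := two_le_card_holes hG hnf hQG hok
      have hsplit := Finset.card_sdiff_add_card_inter W (clF M ((insert z B).erase w))
      rw [Finset.inter_comm]
      omega
    have hsum : ∑ w ∈ A, (((clF M ((insert z B).erase w) ∩ W).card.choose i : ℕ) : ℚ) ≤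
        3 * (((W.card - 2).choose i : ℕ) : ℚ) + 2 * ((f.choose i : ℕ) : ℚ) := by
      rw [← Finset.sum_filter_add_sum_filter_not A (fun w => w = a ∨ w = b)]
      have hAQ : A ⊆ insert z B \ coloops M G := Finset.filter_subset _ _
      have hQ5 : (insert z B \ coloops M G).card = 5 := (rkN_insert_sdiff_coloops_eq_five hG hd hk hB hnP hz).2
      have hc1 : (A.filter (fun w => w = a ∨ w = b)).card ≤ 2 := by
        refine le_trans (Finset.card_le_card (show A.filter (fun w => w = a ∨ w = b) ⊆ {a, b} from ?_)) ?_
        · intro w hw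
          rw [Finset.mem_filter] at hw
          rw [Finset.mem_insert, Finset.mem_singleton]
          exact hw.2
        · exact Finset.card_le_two
      have hc2 : (A.filter (fun w => ¬ (w = a ∨ w = b))).card ≤ 3 := by
        have hsub : A.filter (fun w => ¬ (w = a ∨ w = b)) ⊆ (insert z B \ coloops M G) \ {a, b} := by
          intro w hw
          rw [Finset.mem_filter] at hw
          rw [Finset.mem_sdiff, Finset.mem_insert, Finset.mem_singleton]
          exact ⟨hAQ hw.1, hw.2⟩
        refine le_trans (Finset.card_le_card hsub) ?_
        rw [Finset.card_sdiff_of_subset (by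
          intro w hw
          rw [Finset.mem_insert, Finset.mem_singleton] at hw
          rcases hw with rfl | rfl
          · exact ha
          · exact hb), hQ5, Finset.card_pair hab]
      have h1 : ∑ w ∈ A.filter (fun w => w = a ∨ w = b), (((clF M ((insert z B).erase w) ∩ W).card.choose i : ℕ) : ℚ) ≤
          2 * ((f.choose i : ℕ) : ℚ) := by
        calc ∑ w ∈ A.filter (fun w => w = a ∨ w = b), (((clF M ((insert z B).erase w) ∩ W).card.choose i : ℕ) : ℚ)
            ≤ ∑ _w ∈ A.filter (fun w => w = a ∨ w = b), ((f.choose i : ℕ) : ℚ) := by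
              apply Finset.sum_le_sum
              intro w hw
              rw [Finset.mem_filter] at hw
              have hle : (clF M ((insert z B).erase w) ∩ W).card ≤ f := by
                rw [Finset.inter_comm]
                rcases hw.2 with rfl | rfl
                · exact hfa
                · exact hfb
              exact_mod_cast Nat.choose_le_choose i hle
          _ = ((A.filter (fun w => w = a ∨ w = b)).card : ℚ) * ((f.choose i : ℕ) : ℚ) := by
              rw [Finset.sum_const, nsmul_eq_mul]
          _ ≤ 2 * ((f.choose i : ℕ) : ℚ) := by
              apply mul_le_mul_of_nonneg_right _ (by positivity)
              exact_mod_cast hc1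
      have h2 : ∑ w ∈ A.filter (fun w => ¬ (w = a ∨ w = b)),
          (((clF M ((insert z B).erase w) ∩ W).card.choose i : ℕ) : ℚ) ≤ 3 * (((W.card - 2).choose i : ℕ) : ℚ) := by
        calc ∑ w ∈ A.filter (fun w => ¬ (w = a ∨ w = b)), (((clF M ((insert z B).erase w) ∩ W).card.choose i : ℕ) : ℚ)
            ≤ ∑ _w ∈ A.filter (fun w => ¬ (w = a ∨ w = b)), (((W.card - 2).choose i : ℕ) : ℚ) := by
              apply Finset.sum_le_sum
              intro w hw
              rw [Finset.mem_filter, not_or] at hw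
              have := hface w hw.1 hw.2.1 hw.2.2
              exact_mod_cast Nat.choose_le_choose i (by omega)
          _ = ((A.filter (fun w => ¬ (w = a ∨ w = b))).card : ℚ) * (((W.card - 2).choose i : ℕ) : ℚ) := by
              rw [Finset.sum_const, nsmul_eq_mul]
          _ ≤ 3 * (((W.card - 2).choose i : ℕ) : ℚ) := by
              apply mul_le_mul_of_nonneg_right _ (by positivity)
              exact_mod_cast hc2
      linarith
    have h := card_filter_good_ge' W A (fun w => clF M ((insert z B).erase w)) Susp i
    have hsub : (W.powersetCard i).filter (fun Y => ¬ Susp Y ∧ ∀ w ∈ A, ¬ Y ⊆ clF M ((insert z B).erase w)) ⊆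
        (W.powersetCard i).filter P := by
      intro Y hY
      rw [Finset.mem_filter] at hY ⊢
      exact ⟨hY.1, hY.2.1, Or.inr hY.2.2⟩
    have h1 : ((((W.powersetCard i).filter (fun Y => ¬ Susp Y ∧ ∀ w ∈ A, ¬ Y ⊆ clF M ((insert z B).erase w))).card : ℕ) : ℚ)
        ≤ (((W.powersetCard i).filter P).card : ℚ) := by exact_mod_cast Finset.card_le_card hsub
    linarith

/-- **THE NON-SUSPECT FAMILY THEOREM WITH THE PER-FACE HITTING COUNT**: `1 ≤ ntpIncomeB N s |ℓ₁| |ℓ₂| |C₁| |C₂| f` ⇒ fair. -/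
theorem basis_pair_fair_of_ntpB (hG : G ∈ flatsQ M (5 + 1)) (hd : (gr M \ G).card = 2)
    (hk : kColoops M G = 1) (hs : ∀ e ∈ gr M, ∀ f ∈ gr M, e ≠ f → rkN M {e, f} = 2)
    (hl : ∀ e ∈ gr M, M.Indep {e}) (hnf : fatClosures M 5 G 2 = ∅)
    {B : Finset α} (hB : B ∈ thinMembers M 5 G) (hnP : ¬ bigP M G B) {z : α} (hz : z ∈ G \ clF M B)
    (hl0 : loss M 5 G B z ≠ 0) {ℓ₁ ℓ₂ C₁ C₂ : Finset α} {s f : ℕ} (hs1 : 1 ≤ s) {a b : α}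
    (ha : a ∈ insert z B \ coloops M G) (hb : b ∈ insert z B \ coloops M G) (hab : a ≠ b)
    (hfa : ((G \ insert z B) ∩ clF M ((insert z B).erase a)).card ≤ f)
    (hfb : ((G \ insert z B) ∩ clF M ((insert z B).erase b)).card ≤ f)
    (hdl : ∀ Y ⊆ G \ insert z B, s ≤ Y.card →
      ¬ ((∃ a ∈ insert z B \ coloops M G, ∃ b ∈ insert z B \ coloops M G, a ≠ b ∧
          Y.card ≤ (Y ∩ clF M {a, b}).card + 1) ∨
        ∃ a ∈ insert z B \ coloops M G, ∃ y ∈ Y, Y ⊆ clF M {a, y}) →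
      dload M 5 G (bigP M G) (dshGT2 M 5 G) (insert z B ∪ Y) = 0)
    (hℓ₁ : ℓ₁ ⊆ G \ insert z B) (hℓ₂ : ℓ₂ ⊆ G \ insert z B)
    (hB2 : ∀ a ∈ insert z B \ coloops M G, ∀ b ∈ insert z B \ coloops M G, a ≠ b →
      (G \ insert z B) ∩ clF M {a, b} ⊆ ℓ₁ ∨ (G \ insert z B) ∩ clF M {a, b} ⊆ ℓ₂ ∨
        ((G \ insert z B) ∩ clF M {a, b}).card + 2 ≤ s)
    (hB1 : ∀ a ∈ insert z B \ coloops M G, ∀ y ∈ G \ insert z B,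
      (G \ insert z B) ∩ clF M {a, y} ⊆ C₁ ∨ (G \ insert z B) ∩ clF M {a, y} ⊆ C₂ ∨
        ((G \ insert z B) ∩ clF M {a, y}).card + 1 ≤ s)
    (hsum : 1 ≤ ntpIncomeB (G \ insert z B).card s ℓ₁.card ℓ₂.card C₁.card C₂.card f) :
    loss M 5 G B z ≤ rhoL M 5 G B z * lossIncomeH M 5 G (bigP M G) (dshGT2 M 5 G) B z := by
  have hfat : (fatClosures M 5 G 2).card ≤ 1 := by
    rw [hnf, Finset.card_empty]
    exact zero_le_one
  obtain ⟨hsub, hinc⟩ := ntpB_targets_subset_and_income hG hd hk hnf hB hnP hz hl0 hs1 ha hb hab hfa hfb hdl hℓ₁ hℓ₂ hB2 hB1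
  exact basis_pair_fair_of_vCap_face_sum_subfamily hG hd hk hs hl hfat hB hnP hz hl0 hsub (hsum.trans hinc)

end PercRepro.Shadow
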